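import Mathlib.Tactic
import HarnessLib

/-!
# R-H ROUND 1 (D-0079 «local-height condition I06⋆», D-0107) — SECOND-READER KERNEL NOTE for row 18 «lattice-level-window»:
# the integer NESTING of three typed cells of the hull-reach family (rows 18 ⊂ 8 ⊂ 15), uniform in `(e, m_q, j)`

Bookkeeping / arithmetic file of the abc-iut cell, rung LADDER-ABC:A2.RESCUE.H (plan/rescue/R-H/START-HERE.md; RH-CANDIDATES.tsv rows 8, 15, 18;
second reader abc-iut-rh-typ-11 gen 2 per abc-iut-rh-lead 2026-08-26T18:08:50Z / 18:18:02Z «the 3-line integer implication»). PROOF-ONLY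
(0 definitions, 0 `Prop` facts, no instance, no notation). TAKES NO SIDE on [IUTchIII] Cor. 3.12 or on any author; the three cells are
HYPOTHESIS SHAPES of the R-H table read in the uniform-fibre / realising-orders currency (`m_Θ = j²·m_q`, `m_q = e·H/(2l) ∈ ℤ`):

* MIN (row 18, abc-iut-lens-nearmiss-2's closed-form minorant `HStarLatticeLevelClosedForm`, in orders): `(j²−1)·m ≤ j·(e − r₀)`,
  `r₀ = ⌊e/(p−1)⌋ + 1` the generic inner radius;
* HB (row 8, abc-iut-lens-strengthen-1 / abc-iut-rh-typ-8 `Repair.RHHeightClass…hBand_iff_cells_of_strictMin`): `(j²−1)·m ≤ j·(e − r) + (1 − r)`,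
  `r = r♯ = min_t (p^t − t·e)` off valuation ties (`r♯ ≤ 1` always: `t = 0`), fallback `r = e` at ties;
* SL (row 15, abc-iut-lens-wuc-1 / abc-iut-rh-typ-12 `Repair.RHSlotReach.clause_iff_uniform` at `(A, B) = (1, r♯)`, «R_cons»):
  `e·⌊(j²m − 1)/e⌋ ≤ m − B + j·(e·⌈1/e⌉ − B)`.

CONTENTS (the table facts of HOME/staging/RH/abc-iut-rh-typ-11/ROW18-SECOND-READER.txt as theorems uniform in the integers):
`hb_of_min` — MIN ⟹ HB whenever `r ≤ 1 ≤ r₀` (so at every untied row; the 15 table cells with MIN ∧ ¬HB are exactly tie rows, `r = e ≥ 2`);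
`sl_of_hb` — HB(`r = B`) ⟹ SL (the floor only helps; abc-iut-rp-m2's p460910 proves the H⋆-level version `slotReachWindow_of_hBand`);
`sl_of_min` — MIN ⟹ SL whenever `B ≤ 1 ≤ r₀` (row 18's k1 column is DOMINATED by row 15's: the «MERGED→15» reading);
and two `decide`d witnesses that the converses fail (named cells HEX:4:7@p7.j2 and S-X72@p7.j2 of I06STAR-COLUMNS).
[folklore] integer arithmetic; no IUT object is constructed here. Axioms: standard.
-/

namespace Summit.ABC.IUTFork.Repair.RHLatticeLevelMinorantNesting

/-- **MIN ⟹ HB off ties.** If `(j²−1)·m ≤ j·(e − r₀)` and `r ≤ 1 ≤ r₀`, `0 ≤ j`, then `(j²−1)·m ≤ j·(e − r) + (1 − r)`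
(since `(j+1)·r ≤ j·r₀ + 1`). [folklore] -/
theorem hb_of_min (e r₀ r j m : ℤ) (hj : 0 ≤ j) (hr : r ≤ 1) (hr₀ : 1 ≤ r₀)
    (hmin : (j ^ 2 - 1) * m ≤ j * (e - r₀)) : (j ^ 2 - 1) * m ≤ j * (e - r) + (1 - r) := by
  nlinarith [mul_le_mul_of_nonneg_left hr hj, mul_le_mul_of_nonneg_left hr₀ hj]

/-- **HB (with `r = B`) ⟹ SL (R_cons).** If `(j²−1)·m ≤ j·(e − B) + (1 − B)` and `1 ≤ e` then
`e·⌊(j²m − 1)/e⌋ ≤ m − B + j·(e·⌈1/e⌉ − B)` (Lean: `⌈1/e⌉ = −((−1)/e) = 1`). [folklore] -/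
theorem sl_of_hb (e B j m : ℤ) (he : 1 ≤ e)
    (hhb : (j ^ 2 - 1) * m ≤ j * (e - B) + (1 - B)) :
    e * ((j ^ 2 * m - 1) / e) ≤ m - B + j * (e * (-((-1 : ℤ) / e)) - B) := by
  have hceil : -((-1 : ℤ) / e) = 1 := by
    have h := (Int.ediv_emod_unique (a := -1) (b := e) (r := e - 1) (q := -1) (by omega)).2 ⟨by ring, by omega, by omega⟩
    omega
  have hfloor : e * ((j ^ 2 * m - 1) / e) ≤ j ^ 2 * m - 1 := by
    have h := Int.ediv_mul_le (j ^ 2 * m - 1) (show e ≠ 0 by omega)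
    linarith [mul_comm e ((j ^ 2 * m - 1) / e)]
  rw [hceil, mul_one]
  nlinarith

/-- **MIN ⟹ SL (R_cons)** whenever `B ≤ 1 ≤ r₀`, `1 ≤ e`, `0 ≤ j`: row 18's closed-form cell implies row 15's slot cell at
`(A, B) = (1, B)` — the k1 dominance «MERGED→15» as a statement uniform in `(e, m, j)`. [folklore] -/
theorem sl_of_min (e r₀ B j m : ℤ) (he : 1 ≤ e) (hj : 0 ≤ j) (hB : B ≤ 1) (hr₀ : 1 ≤ r₀)
    (hmin : (j ^ 2 - 1) * m ≤ j * (e - r₀)) :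
    e * ((j ^ 2 * m - 1) / e) ≤ m - B + j * (e * (-((-1 : ℤ) / e)) - B) :=
  sl_of_hb e B j m he (hb_of_min e r₀ B j m hj hB hr₀ hmin)

/-- The converse of `hb_of_min` fails: cell HEX:4:7@p7.j2 of I06STAR-COLUMNS (`p = 7`, `e = 7`, `m_q = 4`, `j = 2`, `r₀ = 2`,
`r♯ = 0`): HB holds (`12 ≤ 15`) while MIN fails (`12 > 10`). [folklore] -/
example : (2 ^ 2 - 1) * (4 : ℤ) ≤ 2 * (7 - 0) + (1 - 0) ∧ ¬ ((2 ^ 2 - 1) * (4 : ℤ) ≤ 2 * (7 - 2)) := by decide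

/-- The converse of `sl_of_hb` fails: cell S-X72@p7.j2 (`e = 2`, `m_q = 1`, `j = 2`, `B = r♯ = 1`): SL holds (`2·⌊3/2⌋ = 2 ≤ 2`)
while HB fails (`3 > 2`). [folklore] -/
example : (2 : ℤ) * ((2 ^ 2 * 1 - 1) / 2) ≤ 1 - 1 + 2 * (2 * (-((-1 : ℤ) / 2)) - 1) ∧
    ¬ ((2 ^ 2 - 1) * (1 : ℤ) ≤ 2 * (2 - 1) + (1 - 1)) := by decide

/-- At a TIE row HB falls back to `r = e`; then MIN ∧ ¬HB happens (the 15 table cells): e.g. HEX:1:7@p7.j1 (`e = 42`, `m_q = 6`,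
`j = 1`, `r₀ = 8`): MIN `0 ≤ 34`, HB(`r = 42`) `0 ≤ −41` false. [folklore] -/
example : (1 ^ 2 - 1) * (6 : ℤ) ≤ 1 * (42 - 8) ∧ ¬ ((1 ^ 2 - 1) * (6 : ℤ) ≤ 1 * (42 - 42) + (1 - 42)) := by decide

end Summit.ABC.IUTFork.Repair.RHLatticeLevelMinorantNesting
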